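import Summits.BirchSwinnertonDyer.BirchSwinnertonDyer.Theorems.SylvesterTwoHeegnerIndexCoupledTelescopeLevelData
import HarnessLib

/-!
# The COUPLED Cassels–Tate telescope, XLIII: the GLOBAL CHOICES of the (T-L1) class system — Heegner points at
# every conductor, level fixers, and COHERENT generators from one inertia element per Kolyvagin prime
# (RESIDUE c v3, crux `UpperOffV0HSYPlus`, stmt-BirchSwinnertonDyer-19804; planner checklist D723 (a))

The rows' class term `c_X(n)` is built at its own level `K[9pn]` from the CM point `y_n`, the fixer `N_n` of the
embedded level, and the derivative `D_{l(n)}` along generators `σ_q^{(n)}` of the `G_q`.  The FLIP between the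
levels `m ∣ ℓm` (`…CoupledTelescopePairFlip`) needs the generators COMPATIBLE along `K[9pm] ⊆ K[9p(ℓm)]`.  This file
makes the three global choices ONCE, as existence statements over choice FUNCTIONS (no definitions):
* `exists_sylvesterPoints` — `y : (n : ℕ) → W₀(K[9pn])` over `φ(τ_{Q^{(n)}})` for every admissible `n`;
* `exists_levelFixers` — `N : ℕ → Subgroup Γ_K`, `g ∈ N m ↔ g ∘ emb_m = emb_m`;
* `restrictScalars_mem_ringClassGal'` — a `K`-automorphism lies in `Gal(K[m]/K)`;
* `zpowers_eq_ringClassGalOver_of_mem_inertia_of_level` — (T15) at free levels;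
* ★ `exists_coherentGenerators` — `σ : (n q : ℕ) → Aut(K[9pn]/ℚ)`: for each prime `q` ONE inertia element
  `τ_q ∈ I(𝔔_q) ⊂ Γ_K` (k-ty1 #17b at the level `q·9p`), restricted to every level `9pn` (`n ≠ 0`); the
  restrictions lie in `Gal(K[9pn]/K)`, are compatible with all inclusions `K[9pn] ⊆ K[9pn']`, and GENERATE
  `G_q = Gal(K[9pn]/K[9pn/q])` whenever `q ∥ n` ((T15) `zpowers_eq_ringClassGalOver_of_mem_inertia`).
Theorems only (no definition / named fact / instance / notation); nothing asserted on 19804; no stub closed;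
X12.CMAtTwo NOT proved; BSD not claimed for any curve.  Sources: [GrossLMS1991] §3 (p. 238–240); [McCallumLMS1991]
§4 (p. 304); [Cox2013] §9.A; [HuShuYin2019] §4.1.  `lean search 'exists_coherentGenerators'` → nothing before this file.
-/

set_option linter.dupNamespace false -- Summits modules are `Summit.<Summit>.<Problem>…` by design
set_option autoImplicit false

noncomputable section

open scoped Classical

namespace Summit.BirchSwinnertonDyer.BirchSwinnertonDyer.Theorems.SylvesterTwoCMFlip

open WeierstrassCurve Field NumberField IsDedekindDomain Finset
open Literature.NumberTheory.EllipticCurves Literature.NumberTheory.GaloisRepresentations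
  Literature.NumberTheory.EllipticCurves.ModularForms
  Literature.NumberTheory.EllipticCurves.HuShuYin2019
  Literature.NumberTheory.EllipticCurves.RingClassField
  Summit.BirchSwinnertonDyer.BirchSwinnertonDyer.Theorems.SylvesterTwoCMData
  Summit.BirchSwinnertonDyer.Rank1Residual.X11b.RingClassTower
  Summit.BirchSwinnertonDyer.Rank1Residual.X11b

variable {K : Type} [Field K] [NumberField K]

/-- **The CM points at every admissible conductor, chosen once.**  For `n ≠ 0` with all prime factors `≡ 2 (3)`
there is `y_n ∈ W₀(K[9pn])` over `φ(τ_{Q^{(n)}})` (`exists_map_eq_phi_sylvesterTau_of_primeFactors`); one choice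
function for all `n`. [cite: GrossLMS1991, §3 (p. 238)] [cite: HuShuYin2019, §4.1 (p. 10 L92)] -/
theorem exists_sylvesterPoints (hK : IsImaginaryQuadratic K) (hdK : NumberField.discr K = -3) (ι : K →+* ℂ)
    {W : WeierstrassCurve ℚ} (Dt : ModularParametrizationData W 243) {p : ℕ} (hp : p % 3 = 1) :
    ∃ y : (n : ℕ) → (W.baseChange (ringClassField K ι (9 * p * n))).toAffine.Point,
      ∀ n, n ≠ 0 → (∀ q ∈ n.primeFactors, q % 3 = 2) →
        Affine.Point.map (W' := W) (ringClassField K ι (9 * p * n)).subtype.toRatAlgHom (y n) =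
          Dt.φ (heegnerTau ((n : ℤ) ^ 2 * (81 * ((p : ℤ) ^ 2 + 4 * p + 16)),
            (n : ℤ) * (-(9 * (4 * (p : ℤ) ^ 2 + 17 * p + 72))), 4 * (p : ℤ) ^ 2 + 18 * p + 81)) := by
  refine ⟨fun n ↦ if h : n ≠ 0 ∧ ∀ q ∈ n.primeFactors, q % 3 = 2 then
    Classical.choose (exists_map_eq_phi_sylvesterTau_of_primeFactors hK hdK ι Dt hp h.1 h.2) else 0,
    fun n hn hn3 ↦ ?_⟩
  simp only [dif_pos (show n ≠ 0 ∧ ∀ q ∈ n.primeFactors, q % 3 = 2 from ⟨hn, hn3⟩)]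
  exact Classical.choose_spec (exists_map_eq_phi_sylvesterTau_of_primeFactors hK hdK ι Dt hp hn hn3)

/-- **The level fixers, chosen once**: `N m = Gal(K̄/emb_m K[m]) ≤ Γ_K`. [cite: GrossLMS1991, §4 (4.1)] -/
theorem exists_levelFixers (ι : K →+* ℂ) (emb : (m : ℕ) → (ringClassField K ι m →+* AlgebraicClosure K))
    (hemb : ∀ (m : ℕ) (k : K), emb m (algebraMap K (ringClassField K ι m) k) = algebraMap K (AlgebraicClosure K) k) :
    ∃ N : ℕ → Subgroup (absoluteGaloisGroup K), ∀ (m : ℕ) (g : absoluteGaloisGroup K), g ∈ N m ↔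
      ∀ x : ringClassField K ι m, (show AlgebraicClosure K ≃ₐ[K] AlgebraicClosure K from g) (emb m x) = emb m x :=
  ⟨fun m ↦ Classical.choose (exists_subgroup_mem_iff (emb m) (hemb m)),
    fun m ↦ Classical.choose_spec (exists_subgroup_mem_iff (emb m) (hemb m))⟩

/-- A `K`-automorphism of `K[m]`, viewed over `ℚ`, lies in `𝒢_m = Gal(K[m]/K)` (McCallum 1991's private lemma,
re-proved). [cite: GrossLMS1991, §3 (𝒢_n)] -/
theorem restrictScalars_mem_ringClassGal' (ι : K →+* ℂ) {m : ℕ}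
    (σ : ringClassField K ι m ≃ₐ[K] ringClassField K ι m) : σ.restrictScalars ℚ ∈ ringClassGal ι m := by
  rw [ringClassGal, mem_fixingSubgroup_iff]
  rintro x ⟨c, hc⟩
  have hx : x = algebraMap K (ringClassField K ι m) c := Subtype.ext hc.symm
  rw [hx, AlgEquiv.smul_def, AlgEquiv.restrictScalars_apply]
  exact σ.commutes c

/-- (T15) `zpowers_eq_ringClassGalOver_of_mem_inertia` at FREE levels `D = q·d`, `N = q·m`. [cite: GrossLMS1991, §3 (p. 238–240)] -/
theorem zpowers_eq_ringClassGalOver_of_mem_inertia_of_level (hK : IsImaginaryQuadratic K) (ι : K →+* ℂ)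
    {q d m D N : ℕ} (hD : q * d = D) (hN : q * m = N) (hq : q.Prime) (hd : d ≠ 0) (hm : m ≠ 0)
    (hqd : ¬ q ∣ d) (hqm : ¬ q ∣ m)
    (hunits₁ : 2 ≤ d ∨ NumberField.discr K < -4) (hunits : 2 ≤ m ∨ NumberField.discr K < -4)
    (hqP : (Ideal.span {(q : 𝓞 K)}).IsPrime) {v : HeightOneSpectrum (𝓞 K)} (hv : (q : 𝓞 K) ∈ v.asIdeal)
    {𝔓 : Ideal (absIntegers (𝓞 K) K)} (h𝔓 : 𝔓 ∈ v.primesAbove)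
    {τ : absoluteGaloisGroup K} (hτ : τ ∈ 𝔓.inertia (absoluteGaloisGroup K))
    (emb₁ : ringClassField K ι D →+* AlgebraicClosure K)
    {σ₁ : ringClassField K ι D ≃ₐ[ℚ] ringClassField K ι D}
    (hσ₁ : Subgroup.zpowers σ₁ = ringClassGalOver ι D d)
    (hτσ₁ : ∀ x, (show AlgebraicClosure K ≃ₐ[K] AlgebraicClosure K from τ) (emb₁ x) = emb₁ (σ₁ x))
    (hle : ringClassField K ι D ≤ ringClassField K ι N)
    (emb : ringClassField K ι N →+* AlgebraicClosure K)
    (hemb : ∀ k : K, emb (algebraMap K (ringClassField K ι N) k) = algebraMap K (AlgebraicClosure K) k)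
    (hcoh : ∀ x : ringClassField K ι D, emb (RingClassField.inclusion ι hle x) = emb₁ x)
    {σ : ringClassField K ι N ≃ₐ[ℚ] ringClassField K ι N}
    (hτσ : ∀ x, (show AlgebraicClosure K ≃ₐ[K] AlgebraicClosure K from τ) (emb x) = emb (σ x)) :
    Subgroup.zpowers σ = ringClassGalOver ι N m := by
  subst hD hN
  exact zpowers_eq_ringClassGalOver_of_mem_inertia hK ι hq hd hm hqd hqm hunits₁ hunits hqP hv h𝔓 hτ emb₁ hσ₁ hτσ₁
    hle emb hemb hcoh hτσ

/-- ★ **COHERENT generators of the `G_q` along HSY's tower, chosen once** (planner checklist D723 (a)/(b)): for the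
coherent embeddings `emb_m : K[m] → K̄` there is ONE family `σ : (n q : ℕ) → Aut(K[9pn]/ℚ)` with (i) every
`σ_q^{(n)}` in `Gal(K[9pn]/K)`, (ii) `σ_q^{(n')} ∘ incl = incl ∘ σ_q^{(n)}` along every `K[9pn] ⊆ K[9pn']`
(`n, n' ≠ 0`), (iii) `⟨σ_q^{(n)}⟩ = G_q = Gal(K[9pn]/K[9pn/q])` whenever `q ∥ n` for a prime `q ∤ 9p` inert in `K`:
each `σ_q^{(n)}` is the restriction of a fixed inertia element `τ_q` above `q`.
[cite: GrossLMS1991, §3 (p. 238–240: G_ℓ = ⟨σ_ℓ⟩, inertia at λ)] [cite: McCallumLMS1991, §4 (p. 304)] [cite: Cox2013, §9.A] -/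
theorem exists_coherentGenerators (hK : IsImaginaryQuadratic K) (ι : K →+* ℂ) {p : ℕ} (hp0 : p ≠ 0)
    (emb : (m : ℕ) → (ringClassField K ι m →+* AlgebraicClosure K))
    (hemb : ∀ (m : ℕ) (k : K), emb m (algebraMap K (ringClassField K ι m) k) = algebraMap K (AlgebraicClosure K) k)
    (hcoh : ∀ (m n : ℕ) (h : ringClassField K ι m ≤ ringClassField K ι n) (x : ringClassField K ι m),
      emb n (RingClassField.inclusion ι h x) = emb m x) :
    ∃ σ : (n q : ℕ) → (ringClassField K ι (9 * p * n) ≃ₐ[ℚ] ringClassField K ι (9 * p * n)),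
      (∀ n q, σ n q ∈ ringClassGal ι (9 * p * n)) ∧
      (∀ (n n' q : ℕ), n ≠ 0 → n' ≠ 0 → ∀ (h : ringClassField K ι (9 * p * n) ≤ ringClassField K ι (9 * p * n'))
        (x : ringClassField K ι (9 * p * n)),
        σ n' q (RingClassField.inclusion ι h x) = RingClassField.inclusion ι h (σ n q x)) ∧
      (∀ n q, n ≠ 0 → q.Prime → ¬ q ∣ 9 * p → (Ideal.span {(q : 𝓞 K)}).IsPrime → q ∣ n → ¬ q ∣ n / q →
        Subgroup.zpowers (σ n q) = ringClassGalOver ι (9 * p * n) (9 * p * n / q)) := by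
  have h9p : 9 * p ≠ 0 := mul_ne_zero (by norm_num) hp0
  -- ### one inertia element `τ_q` per prime `q ∤ 9p` inert in `K`, restricting to a generator at the level `q·9p`
  have hτex : ∀ q : ℕ, q.Prime ∧ ¬ q ∣ 9 * p ∧ (Ideal.span {(q : 𝓞 K)}).IsPrime →
      ∃ (τ : absoluteGaloisGroup K) (v : HeightOneSpectrum (𝓞 K)) (𝔓 : Ideal (absIntegers (𝓞 K) K))
        (σ₁ : ringClassField K ι (q * (9 * p)) ≃ₐ[ℚ] ringClassField K ι (q * (9 * p))),
        (q : 𝓞 K) ∈ v.asIdeal ∧ 𝔓 ∈ v.primesAbove ∧ τ ∈ 𝔓.inertia (absoluteGaloisGroup K) ∧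
        Subgroup.zpowers σ₁ = ringClassGalOver ι (q * (9 * p)) (9 * p) ∧
        ∀ x, (show AlgebraicClosure K ≃ₐ[K] AlgebraicClosure K from τ) (emb _ x) = emb _ (σ₁ x) := by
    rintro q ⟨hq, hq9p, hqP⟩
    have hne : Ideal.span {(q : 𝓞 K)} ≠ ⊥ := by
      rw [Ne, Ideal.span_singleton_eq_bot]; exact_mod_cast hq.ne_zero
    let v : HeightOneSpectrum (𝓞 K) := ⟨Ideal.span {(q : 𝓞 K)}, hqP, hne⟩
    have hv : (q : 𝓞 K) ∈ v.asIdeal := Ideal.mem_span_singleton_self _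
    obtain ⟨𝔓, h𝔓⟩ := v.primesAbove_nonempty
    obtain ⟨σ₁, hσ₁⟩ := RingClassGalOverCyclic.exists_zpowers_eq_ringClassGalOver_mul hK ι h9p hq hq9p hqP
    obtain ⟨τ, hτ, hτσ₁, -⟩ := exists_mem_inertia_generator_and_forall_exists_pow hK ι hq h9p hq9p hv hqP
      (emb _) (hemb _) h𝔓 hσ₁
    exact ⟨τ, v, 𝔓, σ₁, hv, h𝔓, hτ, hσ₁, hτσ₁⟩
  let τf : ℕ → absoluteGaloisGroup K := fun q ↦
    if h : q.Prime ∧ ¬ q ∣ 9 * p ∧ (Ideal.span {(q : 𝓞 K)}).IsPrime then Classical.choose (hτex q h) else 1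
  have hτf : ∀ q (h : q.Prime ∧ ¬ q ∣ 9 * p ∧ (Ideal.span {(q : 𝓞 K)}).IsPrime), τf q = Classical.choose (hτex q h) :=
    fun q h ↦ by simp only [τf, dif_pos h]
  -- ### the restriction of `τ_q` to every level `9pn`, `n ≠ 0`
  have hres : ∀ n : ℕ, n ≠ 0 → ∀ q, ∃ σ : ringClassField K ι (9 * p * n) ≃ₐ[K] ringClassField K ι (9 * p * n),
      ∀ x, (show AlgebraicClosure K ≃ₐ[K] AlgebraicClosure K from τf q) (emb _ x) = emb _ (σ x) := by
    intro n hn q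
    haveI := (finiteDimensional_and_isGalois_ringClassField hK ι (mul_ne_zero h9p hn)).2
    exact exists_algEquiv_comp_eq (emb (9 * p * n)) (hemb _) (τf q)
  let σf : (n q : ℕ) → (ringClassField K ι (9 * p * n) ≃ₐ[ℚ] ringClassField K ι (9 * p * n)) := fun n q ↦
    if hn : n ≠ 0 then (Classical.choose (hres n hn q)).restrictScalars ℚ else 1
  have hσf : ∀ n (hn : n ≠ 0) q x, (show AlgebraicClosure K ≃ₐ[K] AlgebraicClosure K from τf q) (emb _ x) =
      emb (9 * p * n) (σf n q x) := by
    intro n hn q x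
    simp only [σf, dif_pos hn, AlgEquiv.restrictScalars_apply]
    exact Classical.choose_spec (hres n hn q) x
  refine ⟨σf, fun n q ↦ ?_, fun n n' q hn hn' h x ↦ ?_, fun n q hn hq hq9p hqP hqn hqn' ↦ ?_⟩
  · -- (i) in `Gal(K[9pn]/K)`
    by_cases hn : n ≠ 0
    · simp only [σf, dif_pos hn]; exact restrictScalars_mem_ringClassGal' ι _
    · simp only [σf, dif_neg hn]; exact one_mem _
  · -- (ii) coherence: both are restrictions of `τ_q`
    exact apply_inclusion_eq_of_restrict ι h (emb _) (emb _) (fun y ↦ hcoh _ _ h y) (hσf n hn q) (hσf n' hn' q) x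
  · -- (iii) generation at `q ∥ n`
    have hcond : q.Prime ∧ ¬ q ∣ 9 * p ∧ (Ideal.span {(q : 𝓞 K)}).IsPrime := ⟨hq, hq9p, hqP⟩
    obtain ⟨v, 𝔓, σ₁, hv, h𝔓, hτ, hσ₁, hτσ₁⟩ := Classical.choose_spec (hτex q hcond)
    rw [← hτf q hcond] at hτ hτσ₁
    have hm : 9 * p * n / q = 9 * p * (n / q) := Nat.mul_div_assoc _ hqn
    have hm0 : 9 * p * (n / q) ≠ 0 := mul_ne_zero h9p ((Nat.div_ne_zero_iff_of_dvd hqn).mpr ⟨hn, hq.ne_zero⟩)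
    have hqm : ¬ q ∣ 9 * p * (n / q) := fun h' ↦ by
      rcases (Nat.Prime.dvd_mul hq).mp h' with h'' | h''
      · exact hq9p h''
      · exact hqn' h''
    have hle : ringClassField K ι (q * (9 * p)) ≤ ringClassField K ι (9 * p * n) :=
      ringClassField_mono hK ι (by rw [mul_comm]; exact mul_dvd_mul_left _ hqn) (mul_ne_zero h9p hn)
    have hunits : ∀ {k : ℕ}, k ≠ 0 → 2 ≤ 9 * p * k ∨ NumberField.discr K < -4 := fun {k} hk ↦ by
      left; have : 1 ≤ p * k := Nat.one_le_iff_ne_zero.mpr (mul_ne_zero hp0 hk); nlinarith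
    have hN : q * (9 * p * (n / q)) = 9 * p * n := by rw [Nat.mul_left_comm, Nat.mul_div_cancel' hqn]
    have hunits₁ : 2 ≤ 9 * p ∨ NumberField.discr K < -4 := by left; omega
    rw [hm]
    exact zpowers_eq_ringClassGalOver_of_mem_inertia_of_level hK ι rfl hN hq h9p hm0 hq9p hqm hunits₁
      (hunits ((Nat.div_ne_zero_iff_of_dvd hqn).mpr ⟨hn, hq.ne_zero⟩)) hqP hv h𝔓 hτ
      (emb _) hσ₁ hτσ₁ hle (emb _) (hemb _) (fun y ↦ hcoh _ _ hle y) (hσf n hn q)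

end Summit.BirchSwinnertonDyer.BirchSwinnertonDyer.Theorems.SylvesterTwoCMFlip

end
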